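import Summits.CriticalPhenomena.PercolationContinuityZ3.Theses.PercNearOneGluing
import HarnessLib

/-! # Crux `PercNearOneGluing.AdditiveGluing` (stmt-CriticalPhenomena-4576), line `peel` — ONE residual for both open stubs:
# the pair form in the glued weighting at the UN-GLUED designation (`pairGamma`)

TTRL deep seat `prover-ttrlatt-v22472-d0-0` (variant V22472 = `stub_peel`); lands `--supports stmt-CriticalPhenomena-4576`.
No definitions, no named facts.

`pairGamma` (the hypothesis `hR` below, = hypothesis `h` of `stub_peel_of_gluedPairForm` with the size condition `2 ≤ T.card`
dropped): for a weighting `u`, relays `A ∋ b`, a designation `a₀ ∈ argmin_A μ_u(· ↔ b)` of the UN-GLUED `u`, a block `T ∋ s`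
disjoint from `A` with positive glued deficit `D_T > 0`, and `x ∉ A ∪ T`: the pair inequality of `stub_ratioMonotonePair`
holds for `(u/T, S = {s, x}, s)`.  This file shows that `pairGamma` at `T = {s}` IS the registered pair stub
`stub_ratioMonotonePair` (`pairStep_of_pairGamma`; gluing a singleton changes nothing, and the badness of `x` is not used);
the companion file `…PeelOfPairForm.lean` shows that `pairGamma` at `2 ≤ T.card` gives `stub_peel`.  Hence the whole line
`peel` (and with the landed `stub_goodStaysGoodBlock_var22625`, the crux) hangs on the single inequality `pairGamma`.
[cite: KozmaNitzan2024, §3.1 Remark p. 5, §3.2 pp. 12–14]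
-/

namespace Summit.CriticalPhenomena.PercolationContinuityZ3.Theorems

open MeasureTheory Set
open Literature.Probability.LatticeModels (prodBernoulli)
open Literature.Probability.Percolation (BondConfig openConn openConnIn openGraph openCluster)
open scoped BigOperators

noncomputable section
open Classical

section PeelPairGamma

open Literature.Probability.LatticeModels Literature.Probability.Percolation

variable {n : ℕ}

/-- Gluing a singleton block changes nothing: the only pair inside `{s}` is the loop. [folklore] -/
theorem peelGlue_glue_singleton (u : Sym2 (Fin n) → unitInterval) (s : Fin n) :
    (fun e : Sym2 (Fin n) => if (∀ y ∈ e, y ∈ ({s} : Finset (Fin n))) ∧ ¬ e.IsDiag then (1 : unitInterval) else u e) = u := by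
  funext e
  rw [if_neg]
  rintro ⟨h1, h2⟩
  apply h2
  induction e using Sym2.ind with
  | h p q =>
    have hp : p = s := Finset.mem_singleton.1 (h1 p (Sym2.mem_mk_left p q))
    have hq : q = s := Finset.mem_singleton.1 (h1 q (Sym2.mem_mk_right p q))
    rw [Sym2.mk_isDiag_iff, hp, hq]

/-- A two-element `Finset` containing `s` is `{s, x}` for some `x ≠ s`. [folklore] -/
theorem peelGlue_pair_of_card_two {S : Finset (Fin n)} {s : Fin n} (hs : s ∈ S) (h2 : S.card = 2) :
    ∃ x : Fin n, x ≠ s ∧ S = ({s, x} : Finset (Fin n)) := by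
  obtain ⟨p, q, hpq, hS⟩ := Finset.card_eq_two.1 h2
  subst hS
  rcases Finset.mem_insert.1 hs with rfl | hq
  · exact ⟨q, fun h => hpq h.symm, rfl⟩
  · rw [Finset.mem_singleton] at hq
    subst hq
    exact ⟨p, hpq, Finset.pair_comm p s⟩

/-- **The registered pair stub `stub_ratioMonotonePair` from `pairGamma`** (take `T = {s}`: `u/{s} = u`, the block data of
`{s}` are the point data of `s`, and `D_{{s}} = μ(a₀↔b) − μ(s↔b) > 0` is the badness of `s`; the badness of the second vertex
is not used). [cite: KozmaNitzan2024, §3.2 pp. 12–14] -/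
theorem pairStep_of_pairGamma
    (hR : ∀ (n : ℕ) (u : Sym2 (Fin n) → unitInterval) (A T : Finset (Fin n)) (b a₀ x s : Fin n) (hb : b ∈ A), Disjoint T A → x ∉ A → x ∉ T → a₀ ∈ A → s ∈ T → (∀ a ∈ A, (prodBernoulli u).real (openConn a₀ b) ≤ (prodBernoulli u).real (openConn a b)) → (prodBernoulli u).real (⋃ v ∈ T, openConn v b) < (prodBernoulli u).real (openConn a₀ b) + (prodBernoulli u).real ((openConn a₀ b)ᶜ ∩ (⋃ v ∈ T, openConn a₀ v) ∩ (⋃ v ∈ T, openConn v b)) → ((prodBernoulli (fun e : Sym2 (Fin n) => if (∀ y ∈ e, y ∈ T) ∧ ¬ e.IsDiag then 1 else u e)).real (openConn s b) + (∑ W ∈ (Finset.univ : Finset (Finset (Fin n))).filter (fun W => s ∈ W ∧ Disjoint W A), (prodBernoulli (fun e : Sym2 (Fin n) => if (∀ y ∈ e, y ∈ T) ∧ ¬ e.IsDiag then 1 else u e)).real {ω : BondConfig (Fin n) | openCluster ω s = (W : Set (Fin n))} * A.inf' ⟨b, hb⟩ (fun a => (prodBernoulli (fun e : Sym2 (Fin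 n) => if (∀ y ∈ e, y ∈ T) ∧ ¬ e.IsDiag then 1 else u e)).real (openConnIn ((W : Set (Fin n))ᶜ) a b))) - (prodBernoulli (fun e : Sym2 (Fin n) => if (∀ y ∈ e, y ∈ T) ∧ ¬ e.IsDiag then 1 else u e)).real (openConn a₀ b)) * (∑ W ∈ (Finset.univ : Finset (Finset (Fin n))).filter (fun W => Disjoint W A), (prodBernoulli (fun e : Sym2 (Fin n) => if (∀ y ∈ e, y ∈ T) ∧ ¬ e.IsDiag then 1 else u e)).real {ω : BondConfig (Fin n) | ∀ z : Fin n, (z ∈ W ↔ ω ∈ ⋃ v ∈ ({s, x} : Finset (Fin n)), openConn v z)} * A.inf' ⟨b, hb⟩ (fun a => (prodBernoulli (fun e : Sym2 (Fin n) => if (∀ y ∈ e, y ∈ T) ∧ ¬ e.IsDiag then 1 else u e)).real (openConnIn ((W : Set (Fin n))ᶜ) a b))) ≤ ((prodBernoulli (fun e : Sym2 (Fin n) => if (∀ y ∈ e, y ∈ T) ∧ ¬ e.IsDiag then 1 else u e)).real (⋃ v ∈ ({s, x} : Finset (Fin n)), openConn v b) + (∑ W ∈ (Finset.univ : Finset (Finset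 (Fin n))).filter (fun W => Disjoint W A), (prodBernoulli (fun e : Sym2 (Fin n) => if (∀ y ∈ e, y ∈ T) ∧ ¬ e.IsDiag then 1 else u e)).real {ω : BondConfig (Fin n) | ∀ z : Fin n, (z ∈ W ↔ ω ∈ ⋃ v ∈ ({s, x} : Finset (Fin n)), openConn v z)} * A.inf' ⟨b, hb⟩ (fun a => (prodBernoulli (fun e : Sym2 (Fin n) => if (∀ y ∈ e, y ∈ T) ∧ ¬ e.IsDiag then 1 else u e)).real (openConnIn ((W : Set (Fin n))ᶜ) a b))) - (prodBernoulli (fun e : Sym2 (Fin n) => if (∀ y ∈ e, y ∈ T) ∧ ¬ e.IsDiag then 1 else u e)).real (openConn a₀ b) - (prodBernoulli (fun e : Sym2 (Fin n) => if (∀ y ∈ e, y ∈ T) ∧ ¬ e.IsDiag then 1 else u e)).real ((openConn a₀ b)ᶜ ∩ (⋃ v ∈ ({s, x} : Finset (Fin n)), openConn a₀ v) ∩ (⋃ v ∈ ({s, x} : Finset (Fin n)), openConn v b))) * (∑ W ∈ (Finset.univ : Finset (Finset (Fin n))).filter (fun W => s ∈ W ∧ Disjoint W A), (prodBernoulli (fun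 e : Sym2 (Fin n) => if (∀ y ∈ e, y ∈ T) ∧ ¬ e.IsDiag then 1 else u e)).real {ω : BondConfig (Fin n) | openCluster ω s = (W : Set (Fin n))} * A.inf' ⟨b, hb⟩ (fun a => (prodBernoulli (fun e : Sym2 (Fin n) => if (∀ y ∈ e, y ∈ T) ∧ ¬ e.IsDiag then 1 else u e)).real (openConnIn ((W : Set (Fin n))ᶜ) a b)))) :
    ∀ (n : ℕ) (u : Sym2 (Fin n) → unitInterval) (A S : Finset (Fin n)) (b a₀ s : Fin n) (hb : b ∈ A),
      Disjoint S A → s ∈ S → a₀ ∈ A →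
      (∀ a ∈ A, (prodBernoulli u).real (openConn a₀ b) ≤ (prodBernoulli u).real (openConn a b)) →
      (∀ v ∈ S, (prodBernoulli u).real (openConn v b) < (prodBernoulli u).real (openConn a₀ b)) →
      S.card = 2 →
      ((prodBernoulli u).real (openConn s b)
          + (∑ W ∈ (Finset.univ : Finset (Finset (Fin n))).filter (fun W => s ∈ W ∧ Disjoint W A),
              (prodBernoulli u).real {ω : BondConfig (Fin n) | openCluster ω s = (W : Set (Fin n))}
                * A.inf' ⟨b, hb⟩ (fun a => (prodBernoulli u).real (openConnIn ((W : Set (Fin n))ᶜ) a b)))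
          - (prodBernoulli u).real (openConn a₀ b))
        * (∑ W ∈ (Finset.univ : Finset (Finset (Fin n))).filter (fun W => Disjoint W A),
              (prodBernoulli u).real
                  {ω : BondConfig (Fin n) | ∀ z : Fin n, (z ∈ W ↔ ω ∈ ⋃ v ∈ S, openConn v z)}
                * A.inf' ⟨b, hb⟩ (fun a => (prodBernoulli u).real (openConnIn ((W : Set (Fin n))ᶜ) a b)))
      ≤ ((prodBernoulli u).real (⋃ v ∈ S, openConn v b)
          + (∑ W ∈ (Finset.univ : Finset (Finset (Fin n))).filter (fun W => Disjoint W A),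
              (prodBernoulli u).real
                  {ω : BondConfig (Fin n) | ∀ z : Fin n, (z ∈ W ↔ ω ∈ ⋃ v ∈ S, openConn v z)}
                * A.inf' ⟨b, hb⟩ (fun a => (prodBernoulli u).real (openConnIn ((W : Set (Fin n))ᶜ) a b)))
          - (prodBernoulli u).real (openConn a₀ b)
          - (prodBernoulli u).real
              ((openConn a₀ b)ᶜ ∩ (⋃ v ∈ S, openConn a₀ v) ∩ (⋃ v ∈ S, openConn v b)))
        * (∑ W ∈ (Finset.univ : Finset (Finset (Fin n))).filter (fun W => s ∈ W ∧ Disjoint W A),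
              (prodBernoulli u).real {ω : BondConfig (Fin n) | openCluster ω s = (W : Set (Fin n))}
                * A.inf' ⟨b, hb⟩ (fun a => (prodBernoulli u).real (openConnIn ((W : Set (Fin n))ᶜ) a b))) := by
  intro n u A S b a₀ s hb hSA hs ha₀ hmin hbad h2
  obtain ⟨x, hxs, rfl⟩ := peelGlue_pair_of_card_two hs h2
  have hxA : x ∉ A := Finset.disjoint_left.1 hSA (by simp)
  have hxT : x ∉ ({s} : Finset (Fin n)) := fun h => hxs (Finset.mem_singleton.1 h)
  have hTA : Disjoint ({s} : Finset (Fin n)) A :=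
    Finset.disjoint_singleton_left.2 (Finset.disjoint_left.1 hSA (Finset.mem_insert_self s {x}))
  have hbad' : (prodBernoulli u).real (⋃ v ∈ ({s} : Finset (Fin n)), openConn v b)
      < (prodBernoulli u).real (openConn a₀ b)
        + (prodBernoulli u).real
            ((openConn a₀ b)ᶜ ∩ (⋃ v ∈ ({s} : Finset (Fin n)), openConn a₀ v)
              ∩ (⋃ v ∈ ({s} : Finset (Fin n)), openConn v b)) := by
    have h1 : (⋃ v ∈ ({s} : Finset (Fin n)), openConn v b : Set (BondConfig (Fin n))) = openConn s b := by
      ext ω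
      simp only [Set.mem_iUnion, exists_prop, Finset.mem_singleton]
      exact ⟨fun ⟨v, hv, h⟩ => hv ▸ h, fun h => ⟨s, rfl, h⟩⟩
    rw [h1]
    have h2 := hbad s (Finset.mem_insert_self s {x})
    have h3 : 0 ≤ (prodBernoulli u).real
        ((openConn a₀ b)ᶜ ∩ (⋃ v ∈ ({s} : Finset (Fin n)), openConn a₀ v) ∩ openConn s b) := measureReal_nonneg
    linarith
  have key := hR n u A {s} b a₀ x s hb hTA hxA hxT ha₀ (Finset.mem_singleton_self s) hmin hbad'
  rw [peelGlue_glue_singleton u s] at key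
  exact key

/-- Registered helper stub `stub_glueSingleton_v22472` of crux stmt-CriticalPhenomena-4576 (TTRL deep seat on `stub_peel`; the
registration handle of this file, whose content theorem is `pairStep_of_pairGamma` — its 7.5 k-char signature exceeds the stub
registry's limit): gluing a singleton block is the identity on weightings. [folklore] -/
theorem stub_glueSingleton_v22472 : ∀ (n : ℕ) (u : Sym2 (Fin n) → unitInterval) (s : Fin n), (fun e : Sym2 (Fin n) => if (∀ y ∈ e, y ∈ ({s} : Finset (Fin n))) ∧ ¬ e.IsDiag then (1 : unitInterval) else u e) = u :=
  fun _ u s => peelGlue_glue_singleton u s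

end PeelPairGamma

end

end Summit.CriticalPhenomena.PercolationContinuityZ3.Theorems
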